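import Mathlib
import HarnessLib
import Summits.CriticalPhenomena.SAWScalingLimit.Theorems.SAWSpinMonotoneQCIdentificationDefs
import Summits.CriticalPhenomena.SAWScalingLimit.Theorems.SAWSpinMonotoneQCIdentificationStepLawWalks
import Summits.CriticalPhenomena.SAWScalingLimit.Theorems.SAWSpinMonotoneQCIdentificationStepLawArcs
import Literature.Probability.RandomPlanarGeometry.HexSAWPathRigidity

/-!
# The boundary step law for the winding (line `eight_fifths_primitive`, stub `stub_noBranching`, S6)

Helper sub-goal of the registered stub `stub_noBranching : NoFoldBound → NoBranching` of the
checked skeleton `Cruxes/QCIdentification/Lines/eight_fifths_primitive.lean` (item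
stmt-CriticalPhenomena-16772); vocabulary of `Theorems/SAWSpinMonotoneQCIdentificationDefs.lean`,
lattice ingredients from `Theorems/SAWSpinMonotoneQCIdentificationStepLawWalks.lean` (walks from
vertex paths, hexagon turnings) and `…StepLawArcs.lean` (the two comparison walks).

**Boundary step law.** Let `Λ` be simply connected, `a ∈ ∂Ω` a boundary source, `s` a site of
`𝕋` and `face s j, face s (j+1), …` the hexagon of `ℍ` around `s` (counterclockwise,
`HexKernel.face`). Suppose the faces `face s (j+1), …, face s (j+m)` (`1 ≤ m ≤ 5`) lie in `Λ`
while the two flanking faces `face s j`, `face s (j+m+1)` do not — an *arc* of the hexagon — and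
let `p_out = {face s j, face s (j+1)}`, `p_in = {face s (j+m+1), face s (j+m)}` be the two
flanking boundary mid-edges. Then the (rigid) windings of the self-avoiding walks from `a` satisfy
`W(p_out) - W(p_in) = π - m·π/3` (`sl_boundary_winding_step`; if `a = p_in` then
`W(p_out) = -m·π/3`, and if `a = p_out` then `W(p_in) = m·π/3`: `sl_boundary_winding_step_src`).
This is the load-bearing lattice input S6 of the combinatorial Gauss–Bonnet proof of
`NoBranching` (the turning budget of the PL developing map along the boundary), and, for the flat
zigzag row (`m = 3`), the statement that consecutive bottom exits have equal winding
(`sl_zigzag_winding_eq`, the reduction behind `stub_lateralUniversality`).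

Proof. By rigidity (`HexMidEdgeSAW.winding_eq_of_mem_boundary`) it suffices to compare ONE walk
to `p_out` with ONE walk to `p_in`. Take any walk `γ'` to `p_in`; it ends at `face s (j+m)`, so
it meets the arc; let `x = face s (j+1+d)` be the FIRST arc vertex on it and `P` the part of
`γ'` before `x` (`HV.exists_first_mem_split`). Then `P` followed by the arc run clockwise from
`x` down to `face s (j+1)` and the exit towards `face s j` is a walk to `p_out`, and `P` followed
by the arc run counterclockwise up to `face s (j+m)` and the exit towards `face s (j+m+1)` is a
walk to `p_in` (`sl_exists_saw_cw`, `sl_exists_saw_ccw`). Their windings share the part up to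
`x`; the vertex before `x` is its outer neighbour `outFace s (j+1+d)` (it is adjacent to `x`,
off the arc, and not a flank since `a ∉ {p_out, p_in}`), so the two remainders are the local
hexagon windings
`π/3 - d·π/3` and `-π/3 + (m-1-d)·π/3` (`sl_winding_outFace_arc_cw/ccw`), whose difference is
`π - m·π/3`. Validated by exact enumeration (work file `scratch_steplaw/steplaw_check.py`:
165 simply connected domains of 6–54 vertices, 47 000 arc instances, 0 failures).

Source: H. Duminil-Copin, S. Smirnov, Ann. of Math. 175 (2012) 1653–1665 (arXiv:1007.0575), §3,
proof of Lemma 2 (boundary windings evaluated by their common value: "the winding of any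
self-avoiding walk from `a` to the bottom part of `α` is `-π` while the winding to the top part
is `π`").
-/

noncomputable section

open scoped BigOperators
open Literature.Probability.LatticeModels Literature.Probability.RandomPlanarGeometry
open Literature.Probability.RandomPlanarGeometry.SAW
open Literature.Barriers.CriticalPhenomena
open Literature.Barriers.CriticalPhenomena.HexKernel

namespace Summit.CriticalPhenomena.SAWScalingLimit.Cruxes.QCIdentification.EightFifthsPrimitive.StepLaw

/-! ### Bookkeeping -/

/-- `fin6` of the value of `t : Fin 6` is `t`. [folklore] -/
theorem fin6_val (t : Fin 6) : HV.fin6 (t : ℕ) = t := by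
  ext; simp [HV.fin6, Nat.mod_eq_of_lt t.2]

/-- The head of `P ++ [x]` read off from `P ++ x :: Q`. [folklore] -/
theorem head_append_singleton_of_head? {α : Type*} (P : List α) (x : α) (Q : List α) (w : α)
    (h : (P ++ x :: Q).head? = some w) : (P ++ [x]).head (by simp) = w := by
  cases P <;> simp_all

/-- Splitting the winding of a polyline of centres at the segment entering `x`. [folklore] -/
theorem winding_split_at (Y : List HexVertex) (hY : Y ≠ []) (x : HexVertex) (T : List HexVertex) :
    winding ((Y ++ x :: T).map hexCenter) = winding ((Y ++ [x]).map hexCenter) +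
      winding (hexCenter (Y.getLast hY) :: hexCenter x :: T.map hexCenter) := by
  obtain ⟨Y', y, rfl⟩ : ∃ Y' y, Y = Y' ++ [y] :=
    ⟨Y.dropLast, Y.getLast hY, (List.dropLast_concat_getLast hY).symm⟩
  rw [List.getLast_concat]
  simp only [List.map_append, List.map_cons, List.map_nil, List.append_assoc,
    List.singleton_append]
  exact winding_append_cons_cons _ _ _ _

/-! ### The step law -/

/-- `p_out ≠ p_in` for an arc of positive length. [folklore] -/
theorem flank_ne (s : Site 2) (j m : Fin 6) (hm : m ≠ 0) :
    s(face s j, face s (j + 1)) ≠ s(face s (j + 1 + m), face s (j + m)) := by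
  have key : ∀ j m : Fin 6, m ≠ 0 →
      ¬ ((j = j + 1 + m ∧ j + 1 = j + m) ∨ (j = j + m ∧ j + 1 = j + 1 + m)) := by decide
  intro h
  rw [Sym2.eq_iff, face_inj, face_inj, face_inj, face_inj] at h
  exact key j m hm h

/-- **Bookkeeping of an arc.** For an arc `face s (j+1), …, face s (j+m)` (`m ≠ 0`) of the
hexagon around `s` lying in `Λ` with both flanks outside: `m = n + 1` with `n ≤ 4`, the arc is
`face s (j+1+fin6 t)`, `t ≤ n`, and the two flanking mid-edges `p_out`, `p_in` are boundary
mid-edges of `Λ`. [folklore] -/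
theorem arc_setup {Λ : Finset HexVertex} (s : Site 2) (j m : Fin 6) (hm : m ≠ 0)
    (hout : face s j ∉ Λ) (hin : ∀ i : Fin 6, i < m → face s (j + 1 + i) ∈ Λ)
    (hout' : face s (j + 1 + m) ∉ Λ) :
    ∃ n : ℕ, n ≤ 4 ∧ (m : ℕ) = n + 1 ∧ j + m = j + 1 + HV.fin6 n ∧
      j + 1 + m = j + 1 + HV.fin6 (n + 1) ∧ (∀ t, t ≤ n → face s (j + 1 + HV.fin6 t) ∈ Λ) ∧
      s(face s j, face s (j + 1)) ∈ hexDomainBoundary Λ ∧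
      s(face s (j + 1 + m), face s (j + m)) ∈ hexDomainBoundary Λ := by
  have hm0 : (m : ℕ) ≠ 0 := fun h => hm (Fin.ext h)
  obtain ⟨n, hn4, hmn⟩ : ∃ n : ℕ, n ≤ 4 ∧ m = HV.fin6 n + 1 := by
    refine ⟨(m : ℕ) - 1, by omega, ?_⟩
    rw [← HV.fin6_succ, Nat.sub_add_cancel (Nat.pos_of_ne_zero hm0), fin6_val]
  have hmval : (m : ℕ) = n + 1 := by rw [hmn, ← HV.fin6_succ, val_fin6_of_lt (by omega)]
  have ejm : j + m = j + 1 + HV.fin6 n := by rw [hmn]; abel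
  have ejm1 : j + 1 + m = j + 1 + HV.fin6 (n + 1) := by rw [hmn, HV.fin6_succ]
  have harc : ∀ t, t ≤ n → face s (j + 1 + HV.fin6 t) ∈ Λ := by
    intro t ht
    apply hin
    rw [Fin.lt_def, val_fin6_of_lt (by omega), hmval]
    omega
  refine ⟨n, hn4, hmval, ejm, ejm1, harc, ?_, ?_⟩
  · exact ⟨by simpa using adj_face_succ s j, _, _, rfl, by simpa using harc 0 (Nat.zero_le _),
      hout⟩
  · refine ⟨?_, _, _, rfl, by rw [ejm]; exact harc _ le_rfl, hout'⟩
    have h := adj_face_succ s (j + m)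
    rw [show j + m + 1 = j + 1 + m by abel] at h
    simpa using h.symm

/-- **Boundary step law for the winding (two-sided form).** For `Λ` simply connected, a
boundary source `a`, and an arc `face s (j+1), …, face s (j+m)` (`m ≠ 0`) of the hexagon around
the site `s` lying in `Λ` with both flanks `face s j`, `face s (j+1+m)` outside `Λ`, the windings
of any walk `γ : a → p_out = {face s j, face s (j+1)}` and any walk
`γ' : a → p_in = {face s (j+1+m), face s (j+m)}` (`p_out, p_in ≠ a`) satisfy
`W_γ - W_γ' = π - m·π/3`. [cite: DuminilCopinSmirnov2012, §3 proof of Lemma 2] -/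
theorem sl_boundary_winding_step : ∀ (Λ : Finset HexVertex), hexDomainSimplyConnected Λ → ∀ a ∈ hexDomainBoundary Λ, ∀ (s : Site 2) (j m : Fin 6), m ≠ 0 → HexKernel.face s j ∉ Λ → (∀ i : Fin 6, i < m → HexKernel.face s (j + 1 + i) ∈ Λ) → HexKernel.face s (j + 1 + m) ∉ Λ → s(HexKernel.face s j, HexKernel.face s (j + 1)) ≠ a → s(HexKernel.face s (j + 1 + m), HexKernel.face s (j + m)) ≠ a → ∀ (γ : HexMidEdgeSAW Λ a s(HexKernel.face s j, HexKernel.face s (j + 1))) (γ' : HexMidEdgeSAW Λ a s(HexKernel.face s (j + 1 + m), HexKernel.face s (j + m))), γ.winding - γ'.winding = Real.pi - (m : ℕ) * (Real.pi / 3) := by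
  intro Λ hΛ a ha s j m hm hout hin hout' h₁ h₂ γ γ'
  have ha' := ha
  obtain ⟨haE, u, w₁, rfl, hw₁, hu⟩ := ha
  have hadj : hexGraph.Adj u w₁ := by simpa using haE
  have haM : s(u, w₁) ∈ hexDomainMidEdges Λ := hexDomainBoundary_subset Λ ha'
  obtain ⟨n, hn4, hmval, ejm, ejm1, harc, hbo, hbi⟩ := arc_setup s j m hm hout hin hout'
  -- the given walk to `p_in` ends at the last arc vertex
  have hne' : γ'.verts ≠ [] := fun h => h₂ (γ'.eq_of_nil h).symm
  have hlast' : γ'.verts.getLast hne' = face s (j + m) := by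
    rcases γ'.getLast_eq_or hne' with h | h
    · exact absurd (h ▸ γ'.subset _ (List.getLast_mem hne')) hout'
    · exact h
  -- the first arc vertex on it
  set ARC : List HexVertex := (List.range (n + 1)).map (fun t => face s (j + 1 + HV.fin6 t))
    with hARC
  have hmemARC : ∀ x, x ∈ ARC ↔ ∃ t, t ≤ n ∧ x = face s (j + 1 + HV.fin6 t) := by
    intro x
    simp only [hARC, List.mem_map, List.mem_range]
    constructor
    · rintro ⟨t, ht, rfl⟩; exact ⟨t, by omega, rfl⟩
    · rintro ⟨t, ht, rfl⟩; exact ⟨t, by omega, rfl⟩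
  have hARCΛ : ∀ x ∈ ARC, x ∈ Λ := fun x hx => by
    obtain ⟨t, ht, rfl⟩ := (hmemARC x).1 hx; exact harc t ht
  obtain ⟨P, x, Q, hsplit, hxA, hPA⟩ := HV.exists_first_mem_split γ'.verts ARC
    ⟨face s (j + m), by have h := List.getLast_mem hne'; rwa [hlast'] at h,
      (hmemARC _).2 ⟨n, le_rfl, by rw [ejm]⟩⟩
  obtain ⟨d, hdn, rfl⟩ := (hmemARC x).1 hxA
  obtain ⟨d', rfl⟩ : ∃ d', n = d + d' := ⟨n - d, by omega⟩
  set k : Fin 6 := j + 1 + HV.fin6 d with hk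
  -- the prefix `P`
  have hPΛ : ∀ y ∈ P, y ∈ Λ := fun y hy =>
    γ'.subset y (by rw [hsplit]; exact List.mem_append_left _ hy)
  have hPc : (P ++ [face s k]).IsChain hexGraph.Adj := by
    have hc := γ'.isChain
    rw [hsplit] at hc
    exact (List.isChain_split.1 hc).1
  have hPn : P.Nodup := by
    have hnd := γ'.nodup
    rw [hsplit] at hnd
    exact hnd.sublist (List.sublist_append_left _ _)
  have hPA' : ∀ y ∈ P, ∀ t, t ≤ d + d' → y ≠ face s (j + 1 + HV.fin6 t) :=
    fun y hy t ht h => hPA y hy ((hmemARC y).2 ⟨t, ht, h⟩)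
  have hP0 : (P ++ face s k :: Q).head? = some w₁ := by
    rw [← hsplit, List.head?_eq_some_head hne', γ'.head_eq rfl hu hne']
  have hPh : (P ++ [face s k]).head (by simp) = w₁ := head_append_singleton_of_head? P _ Q w₁ hP0
  -- the two comparison walks
  obtain ⟨ηo, hηo⟩ := sl_exists_saw_cw Λ u w₁ hu haM s j d (by omega)
    (fun t ht => harc t (by omega)) hout P hPΛ hPc hPn (fun y hy t ht => hPA' y hy t (by omega))
    hPh h₁
  obtain ⟨ηi, hηi⟩ := sl_exists_saw_ccw Λ u w₁ hu haM s j d d' hn4 harc P hPΛ hPc hPn hPA' hPh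
    (face s (j + 1 + m)) (face s (j + m)) (by rw [ejm1]) (by rw [ejm]) hout' h₂
  -- the vertex before `x = face s k` is its outer neighbour
  set y : HexVertex := (u :: P).getLast (List.cons_ne_nil _ _) with hy
  have hy_cases : (y = u ∧ P = []) ∨ y ∈ P := by
    rcases eq_or_ne P [] with hP | hP
    · left; exact ⟨by simp [hy, hP], hP⟩
    · right; rw [hy, List.getLast_cons hP]; exact List.getLast_mem hP
  have hw₁P : P = [] → w₁ = face s k := fun hP => by simpa [hP] using hPh.symm
  have hyadj : hexGraph.Adj y (face s k) := by
    have hc : ((u :: P) ++ face s k :: Q).IsChain hexGraph.Adj := by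
      rw [List.cons_append, ← hsplit]
      refine List.isChain_cons.2 ⟨fun b hb => ?_, γ'.isChain⟩
      rw [List.head?_eq_some_head hne', γ'.head_eq rfl hu hne', Option.mem_def,
        Option.some.injEq] at hb
      exact hb ▸ hadj
    exact (List.isChain_append.1 hc).2.2 y (by simp [hy, List.getLast?_eq_some_getLast])
      (face s k) (by simp)
  have hy1 : y ≠ face s (k + 1) := by
    intro hyk
    have ek : k + 1 = j + 1 + HV.fin6 (d + 1) := by rw [HV.fin6_succ, hk, add_assoc]
    rcases Nat.lt_or_ge d (d + d') with hlt | hge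
    · have hmem : face s (k + 1) ∈ ARC := (hmemARC _).2 ⟨d + 1, by omega, by rw [ek]⟩
      rcases hy_cases with ⟨hyu, -⟩ | hyP
      · exact hu (hyu ▸ hyk ▸ hARCΛ _ hmem)
      · exact hPA y hyP (hyk ▸ hmem)
    · have hd' : d' = 0 := by omega
      have ek' : face s (k + 1) = face s (j + 1 + m) := by
        rw [ek, ejm1, hd']
      rcases hy_cases with ⟨hyu, hP⟩ | hyP
      · refine h₂ ?_
        rw [← ek', ← hyk, hyu, hw₁P hP, ejm, hk, hd', add_zero]
      · exact hout' (ek' ▸ hyk ▸ hPΛ y hyP)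
  have hy2 : y ≠ face s (k - 1) := by
    intro hyk
    rcases Nat.eq_zero_or_pos d with hd0 | hdp
    · have ek' : face s (k - 1) = face s j := by rw [hk, hd0]; simp
      rcases hy_cases with ⟨hyu, hP⟩ | hyP
      · refine h₁ ?_
        rw [← ek', ← hyk, hyu, hw₁P hP, hk, hd0]
        simp
      · exact hout (ek' ▸ hyk ▸ hPΛ y hyP)
    · have ek : k - 1 = j + 1 + HV.fin6 (d - 1) := by
        obtain ⟨d₀, rfl⟩ : ∃ d₀, d = d₀ + 1 := ⟨d - 1, by omega⟩
        rw [hk, HV.fin6_succ, Nat.add_sub_cancel]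
        abel
      have hmem : face s (k - 1) ∈ ARC := (hmemARC _).2 ⟨d - 1, by omega, by rw [ek]⟩
      rcases hy_cases with ⟨hyu, -⟩ | hyP
      · exact hu (hyu ▸ hyk ▸ hARCΛ _ hmem)
      · exact hPA y hyP (hyk ▸ hmem)
  have hyo : y = outFace s k := by
    rcases (adj_face_iff' s k y).1 hyadj.symm with h | h | h
    · exact absurd h hy2
    · exact absurd h hy1
    · exact h
  -- the windings of the two comparison walks beyond the common prefix
  have hyo' : (u :: P).getLast (List.cons_ne_nil _ _) = outFace s k := hyo
  have hWo : ηo.winding = winding (((u :: P) ++ [face s k]).map hexCenter) +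
      (Real.pi / 3 - d * (Real.pi / 3)) := by
    rw [hηo, arcDn_succ]
    change winding ((((u :: P) ++ face s k ::
      ((List.range (d + 1)).map fun t => face s (k - 1 - HV.fin6 t)))).map hexCenter) = _
    rw [winding_split_at (u :: P) (List.cons_ne_nil _ _) (face s k)
      ((List.range (d + 1)).map fun t => face s (k - 1 - HV.fin6 t)), hyo']
    congr 1
    rw [← List.map_cons, ← arcDn_succ]
    exact sl_winding_outFace_arc_cw s d k
  have hWi : ηi.winding = winding (((u :: P) ++ [face s k]).map hexCenter) +
      (-(Real.pi / 3) + d' * (Real.pi / 3)) := by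
    rw [hηi, arcUp_succ]
    change winding ((((u :: P) ++ face s k ::
      ((List.range (d' + 1)).map fun t => face s (k + 1 + HV.fin6 t)))).map hexCenter) = _
    rw [winding_split_at (u :: P) (List.cons_ne_nil _ _) (face s k)
      ((List.range (d' + 1)).map fun t => face s (k + 1 + HV.fin6 t)), hyo']
    congr 1
    rw [← List.map_cons, ← arcUp_succ]
    exact sl_winding_outFace_arc_ccw s d' k
  rw [HexMidEdgeSAW.winding_eq_of_mem_boundary hΛ ha' hbo γ ηo,
    HexMidEdgeSAW.winding_eq_of_mem_boundary hΛ ha' hbi γ' ηi, hWo, hWi, hmval]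
  push_cast
  ring

/-- **Boundary step law, source at the counterclockwise flank.** If the source is
`a = p_in = {face s (j+1+m), face s (j+m)}` itself, every walk `a → p_out = {face s j,
face s (j+1)}` has winding `-m·π/3` (the arc run clockwise: `m` right turns).
[cite: DuminilCopinSmirnov2012, §3 proof of Lemma 2] -/
theorem boundary_winding_step_src_in {Λ : Finset HexVertex} (hΛ : hexDomainSimplyConnected Λ)
    (s : Site 2) (j m : Fin 6) (hm : m ≠ 0) (hout : face s j ∉ Λ)
    (hin : ∀ i : Fin 6, i < m → face s (j + 1 + i) ∈ Λ) (hout' : face s (j + 1 + m) ∉ Λ)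
    (γ : HexMidEdgeSAW Λ s(face s (j + 1 + m), face s (j + m)) s(face s j, face s (j + 1))) :
    γ.winding = -((m : ℕ) * (Real.pi / 3)) := by
  obtain ⟨n, hn4, hmval, ejm, ejm1, harc, hbo, hbi⟩ := arc_setup s j m hm hout hin hout'
  obtain ⟨η, hη⟩ := sl_exists_saw_cw Λ (face s (j + 1 + m)) (face s (j + m)) hout'
    (hexDomainBoundary_subset Λ hbi) s j n hn4 harc hout [] (by simp) (by simp) List.nodup_nil
    (by simp) (by simp [ejm]) (flank_ne s j m hm)
  rw [HexMidEdgeSAW.winding_eq_of_mem_boundary hΛ hbi hbo γ η, hη, List.nil_append,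
    List.map_cons, show face s (j + 1 + m) = face s (j + 1 + HV.fin6 n + 1) by
      rw [ejm1, HV.fin6_succ, ← add_assoc], winding_face_arc_cw s n, hmval]
  push_cast
  ring

/-- **Boundary step law, source at the clockwise flank.** If the source is
`a = p_out = {face s j, face s (j+1)}` itself, every walk `a → p_in = {face s (j+1+m),
face s (j+m)}` has winding `m·π/3` (the arc run counterclockwise: `m` left turns).
[cite: DuminilCopinSmirnov2012, §3 proof of Lemma 2] -/
theorem boundary_winding_step_src_out {Λ : Finset HexVertex} (hΛ : hexDomainSimplyConnected Λ)
    (s : Site 2) (j m : Fin 6) (hm : m ≠ 0) (hout : face s j ∉ Λ)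
    (hin : ∀ i : Fin 6, i < m → face s (j + 1 + i) ∈ Λ) (hout' : face s (j + 1 + m) ∉ Λ)
    (γ' : HexMidEdgeSAW Λ s(face s j, face s (j + 1)) s(face s (j + 1 + m), face s (j + m))) :
    γ'.winding = (m : ℕ) * (Real.pi / 3) := by
  obtain ⟨n, hn4, hmval, ejm, ejm1, harc, hbo, hbi⟩ := arc_setup s j m hm hout hin hout'
  obtain ⟨η, hη⟩ := sl_exists_saw_ccw Λ (face s j) (face s (j + 1)) hout
    (hexDomainBoundary_subset Λ hbo) s j 0 n (by simpa using hn4) (by simpa using harc) []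
    (by simp) (by simp) List.nodup_nil (by simp) (by simp) (face s (j + 1 + m)) (face s (j + m))
    (by rw [zero_add, ← ejm1]) (by rw [zero_add, ← ejm]) hout' (flank_ne s j m hm).symm
  rw [HexMidEdgeSAW.winding_eq_of_mem_boundary hΛ hbo hbi γ' η, hη, List.nil_append,
    List.map_cons, show face s j = face s (j + 1 + HV.fin6 0 - 1) by simp,
    winding_face_arc_ccw s n, hmval]
  push_cast
  ring

/-- **Boundary step law, one-sided forms (registered).** For an arc `face s (j+1), …,
face s (j+m)` (`m ≠ 0`) of the hexagon around `s` in the simply connected `Λ` with both flanks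
outside: if the source is the counterclockwise flank `p_in = {face s (j+1+m), face s (j+m)}`,
every walk to `p_out = {face s j, face s (j+1)}` has winding `-m·π/3`; if the source is `p_out`,
every walk to `p_in` has winding `m·π/3`. [cite: DuminilCopinSmirnov2012, §3 proof of Lemma 2] -/
theorem sl_boundary_winding_step_src : ∀ (Λ : Finset HexVertex), hexDomainSimplyConnected Λ → ∀ (s : Site 2) (j m : Fin 6), m ≠ 0 → HexKernel.face s j ∉ Λ → (∀ i : Fin 6, i < m → HexKernel.face s (j + 1 + i) ∈ Λ) → HexKernel.face s (j + 1 + m) ∉ Λ → (∀ (γ : HexMidEdgeSAW Λ s(HexKernel.face s (j + 1 + m), HexKernel.face s (j + m)) s(HexKernel.face s j, HexKernel.face s (j + 1))), γ.winding = -((m : ℕ) * (Real.pi / 3))) ∧ (∀ (γ' : HexMidEdgeSAW Λ s(HexKernel.face s j, HexKernel.face s (j + 1)) s(HexKernel.face s (j + 1 + m), HexKernel.face s (j + m))), γ'.winding = (m : ℕ) * (Real.pi / 3)) :=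
  fun _ hΛ s j m hm hout hin hout' =>
    ⟨fun γ => boundary_winding_step_src_in hΛ s j m hm hout hin hout' γ,
      fun γ' => boundary_winding_step_src_out hΛ s j m hm hout hin hout' γ'⟩

/-! ### The flat zigzag row: consecutive bottom exits have equal winding -/

/-- Transport of a walk along an equality of target mid-edges does not change its winding.
[folklore] -/
theorem winding_cast {Λ : Finset HexVertex} {a z z' : Sym2 HexVertex} (h : z = z')
    (γ : HexMidEdgeSAW Λ a z) : (h ▸ γ).winding = γ.winding := by
  subst h; rfl

/-- **Equal windings of consecutive bottom exits of a flat zigzag row** (the winding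
reduction behind `stub_lateralUniversality`): if the bottom vertices `(x,0)`, `(x+e₀,0)` and
the vertex `(x,1)` between them lie in `Λ` while `(x-e₁,1)`, `(x+e₀-e₁,1)` below do not, the
downward boundary mid-edges `p = {(x,0), (x-e₁,1)}` and `p' = {(x+e₀,0), (x+e₀-e₁,1)}` flank the
arc `face s 0, face s 1, face s 2` of the hexagon around `s = x + e₀` (`m = 3`), so every walk
`a → p` and every walk `a → p'` have the same winding (`π - 3·π/3 = 0`).
[cite: DuminilCopinSmirnov2012, §3 proof of Lemma 2] -/
theorem sl_zigzag_winding_eq : ∀ (Λ : Finset HexVertex), hexDomainSimplyConnected Λ → ∀ a ∈ hexDomainBoundary Λ, ∀ (x : Site 2), ((x, 0) : HexVertex) ∈ Λ → ((x, 1) : HexVertex) ∈ Λ → ((x + Pi.single 0 1, 0) : HexVertex) ∈ Λ → ((x - Pi.single 1 1, 1) : HexVertex) ∉ Λ → ((x + Pi.single 0 1 - Pi.single 1 1, 1) : HexVertex) ∉ Λ → s(((x, 0) : HexVertex), (x - Pi.single 1 1, 1)) ≠ a → s(((x + Pi.single 0 1, 0) : HexVertex), (x + Pi.single 0 1 - Pi.single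 1 1, 1)) ≠ a → ∀ (γ : HexMidEdgeSAW Λ a s(((x, 0) : HexVertex), (x - Pi.single 1 1, 1))) (γ' : HexMidEdgeSAW Λ a s(((x + Pi.single 0 1, 0) : HexVertex), (x + Pi.single 0 1 - Pi.single 1 1, 1))), γ.winding = γ'.winding := by
  intro Λ hΛ a ha x h0 h1 h0' hb hb' hp hp' γ γ'
  -- the hexagon around `s = x + e₀`: faces `5` and `3` are out, `0, 1, 2` are in
  have e5 : face (x + unitE0) 5 = (x + Pi.single 0 1 - Pi.single 1 1, 1) := by simp [face]
  have e0 : face (x + unitE0) (5 + 1) = (x + Pi.single 0 1, 0) := by simp [face]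
  have e3 : face (x + unitE0) (5 + 1 + 3) = (x - Pi.single 1 1, 1) := by simp [face]
  have e2 : face (x + unitE0) (5 + 3) = (x, 0) := by simp [face]
  have Eout : s(((x + Pi.single 0 1, 0) : HexVertex), (x + Pi.single 0 1 - Pi.single 1 1, 1)) =
      s(face (x + unitE0) 5, face (x + unitE0) (5 + 1)) := by rw [e5, e0, Sym2.eq_swap]
  have Ein : s(((x, 0) : HexVertex), (x - Pi.single 1 1, 1)) =
      s(face (x + unitE0) (5 + 1 + 3), face (x + unitE0) (5 + 3)) := by rw [e3, e2, Sym2.eq_swap]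
  have hin : ∀ i : Fin 6, i < 3 → face (x + unitE0) (5 + 1 + i) ∈ Λ := by
    intro i hi
    fin_cases i <;> simp [face] at hi ⊢ <;> assumption
  have key := sl_boundary_winding_step Λ hΛ a ha (x + unitE0) 5 3 (by decide) (e5 ▸ hb') hin
    (e3 ▸ hb) (Eout ▸ hp') (Ein ▸ hp) (Eout ▸ γ') (Ein ▸ γ)
  rw [winding_cast, winding_cast] at key
  have h3 : (((3 : Fin 6) : ℕ) : ℝ) = 3 := by norm_num
  rw [h3] at key
  linarith

end Summit.CriticalPhenomena.SAWScalingLimit.Cruxes.QCIdentification.EightFifthsPrimitive.StepLaw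

end
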